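import Mathlib
import Summits.NavierStokesRegularity.NavierStokesRegularity.Theorems.WakeRatchetTailRatchetQuietPastViscousLine
import HarnessLib

/-!
# `WakeRatchet.TailRatchet` (stmt-NavierStokesRegularity-21808) — hypothesis class of the tail ratchets:
# FAR-PAST FRAME SEQUENCES (the input of an α-limit extraction), packaged

Support file (route `WakeRatchet`; MODEL lattice ODEs of Tao 2016 §4 / §6.4 — nothing here concerns the Navier–Stokes
equations; no item is closed).  Eighth file of the `WakeRatchetQuietPast` series: the sequence form of
`uniformly_loud_past`, `loud_below_viscous_line` and `loud_shells_below`, i.e. exactly what a compactness (Arzelà–Ascoli,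
tree kit `WakeRatchetExtraction*`) extraction of an ANCIENT PROFILE from a member of the hypothesis class of
stmt-21808 / 25584 / 25646 / 25647 starts from.

For a non-trivial uniformly bounded (`‖W_j‖ ≤ C`) admissible eternal solution of ANY table with covariant viscosity
`ν̂ ≥ 0` (`K > 0` a bound of `C_Q + Λ C_A + Λ⁻¹ C_B`):

* `exists_loud_frames` — there are shells `k_j` and log-times `s_j → −∞` (indeed `s_j ≤ −j`) with
  `‖W_{k_j}(s_j)‖ > 1/(64K)` and BOUNDED DISSIPATION NUMBERS `ν̂ (1+ε₀)^{2k_j} e^{−s_j} < (4KC³+1)(64K)²` — so the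
  recentred frames `W^{(j)}_n(σ) = W_{n+k_j}(σ + s_j)` are eternal solutions of the same lattice with viscosity parameters
  in a fixed compact range and amplitude `> 1/(64K)` at the origin;
* `exists_loud_frames_visc` — if `ν̂ > 0` and `ε₀ > 0`, the shells can moreover be taken with `k_j ≤ −j` (drift to `−∞`).

HONEST FRAMING: elementary repackaging; no stub, crux, rung or summit is proved (stmt-21808 stays dead modulo the
construction `WakeRatchetDyadicFront.DyadicScalarFronts`); the extraction itself is not performed here.
-/

noncomputable section

set_option linter.dupNamespace false

namespace Summit.NavierStokesRegularity.NavierStokesRegularity.Theorems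

namespace WakeRatchetQuietPast

open Set Filter Topology
open Literature.Analysis.FluidPDE Literature.Analysis.FluidPDE.TaoCascade

variable {m : ℕ} {ε₀ νh : ℝ} {α : Fin m → Fin m → Fin m → ℤ × ℤ × ℤ → ℝ} {W : ℤ → ℝ → Em m}

/-- **Loud far-past frames with bounded dissipation number.**  For a non-trivial uniformly bounded admissible eternal
solution (any table, any `ν̂ ≥ 0`): shells `k_j` and log-times `s_j ≤ −j` with `‖W_{k_j}(s_j)‖ > 1/(64K)` and
`ν̂ (1+ε₀)^{2k_j} e^{−s_j} < (4KC³+1)(64K)²`.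
[cite: Tao2016AveragedNS, §4 Lemma 4.1 (4.8), §6.4; cell theorem] -/
theorem exists_loud_frames (hε : -1 < ε₀) (hW : IsEternalVisc ε₀ νh α W) {K C : ℝ}
    (hK : shiftConst α (0, 0, 0) + bigLam ε₀ * shiftConst α (0, 0, 1)
      + (bigLam ε₀)⁻¹ * (shiftConst α (1, 0, 0) + shiftConst α (0, 1, 0)) ≤ K)
    (hK0 : 0 < K) (hC0 : 0 ≤ C) (hC : ∀ (j : ℤ) (σ : ℝ), ‖W j σ‖ ≤ C) (hne : ∃ (n : ℤ) (σ : ℝ), W n σ ≠ 0) :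
    ∃ (k : ℕ → ℤ) (s : ℕ → ℝ), (∀ j : ℕ, s j ≤ -(j : ℝ)) ∧ Tendsto s atTop atBot ∧
      ∀ j : ℕ, 1 / (64 * K) < ‖W (k j) (s j)‖ ∧
        νh * ((1 + ε₀) ^ ((2 : ℝ) * (k j)) * Real.exp (-(s j))) < (4 * K * C ^ 3 + 1) * (64 * K) ^ 2 := by
  obtain ⟨σ₀, h⟩ := loud_below_viscous_line hε hW hK hK0 hC0 hC hne
  -- at the log-time `s_j := min σ₀ (−j)` pick a loud shell
  have hsj : ∀ j : ℕ, min σ₀ (-(j : ℝ)) ≤ σ₀ := fun j => min_le_left _ _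
  choose k hk using fun j : ℕ => (h (min σ₀ (-(j : ℝ))) (hsj j)).1
  refine ⟨k, fun j => min σ₀ (-(j : ℝ)), fun j => min_le_right _ _, ?_, fun j => ⟨hk j, ?_⟩⟩
  · -- `s_j ≤ -j → -∞`
    refine tendsto_atBot_mono (fun j => min_le_right σ₀ (-(j : ℝ))) ?_
    exact tendsto_neg_atTop_atBot.comp tendsto_natCast_atTop_atTop
  · exact (h (min σ₀ (-(j : ℝ))) (hsj j)).2 (k j) (hk j)

/-- **Loud far-past frames drifting to `−∞`** (`ν̂ > 0`, `ε₀ > 0`): shells `k_j ≤ −j` and log-times `s_j ≤ −j` with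
`‖W_{k_j}(s_j)‖ > 1/(64K)` (and, by `loud_below_viscous_line`, bounded dissipation numbers).
[cite: Tao2016AveragedNS, §4 Lemma 4.1 (4.8), §6.4; cell theorem] -/
theorem exists_loud_frames_visc (hε : 0 < ε₀) (hν : 0 < νh) (hW : IsEternalVisc ε₀ νh α W) {K C : ℝ}
    (hK : shiftConst α (0, 0, 0) + bigLam ε₀ * shiftConst α (0, 0, 1)
      + (bigLam ε₀)⁻¹ * (shiftConst α (1, 0, 0) + shiftConst α (0, 1, 0)) ≤ K)
    (hK0 : 0 < K) (hC0 : 0 ≤ C) (hC : ∀ (j : ℤ) (σ : ℝ), ‖W j σ‖ ≤ C) (hne : ∃ (n : ℤ) (σ : ℝ), W n σ ≠ 0) :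
    ∃ (k : ℕ → ℤ) (s : ℕ → ℝ), (∀ j : ℕ, s j ≤ -(j : ℝ)) ∧ (∀ j : ℕ, k j < -(j : ℤ)) ∧
      ∀ j : ℕ, 1 / (64 * K) < ‖W (k j) (s j)‖ ∧
        νh * ((1 + ε₀) ^ ((2 : ℝ) * (k j)) * Real.exp (-(s j))) < (4 * K * C ^ 3 + 1) * (64 * K) ^ 2 := by
  obtain ⟨σ₀, h⟩ := loud_below_viscous_line (by linarith) hW hK hK0 hC0 hC hne
  have hdrift := fun j : ℕ => loud_shells_below hε hν hW hK hK0 hC0 hC hne (-(j : ℤ))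
  choose σ₁ hσ₁ using hdrift
  -- log-times `s_j := min (min σ₀ (σ₁ j)) (−j)`
  set s : ℕ → ℝ := fun j => min (min σ₀ (σ₁ j)) (-(j : ℝ)) with hs
  have hs₀ : ∀ j, s j ≤ σ₀ := fun j => (min_le_left _ _).trans (min_le_left _ _)
  have hs₁ : ∀ j, s j ≤ σ₁ j := fun j => (min_le_left _ _).trans (min_le_right _ _)
  choose k hk using fun j : ℕ => ((hσ₁ j) (s j) (hs₁ j)).1
  refine ⟨k, s, fun j => min_le_right _ _, fun j => ((hσ₁ j) (s j) (hs₁ j)).2 (k j) (hk j), fun j => ⟨hk j, ?_⟩⟩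
  exact (h (s j) (hs₀ j)).2 (k j) (hk j)

end WakeRatchetQuietPast

end Summit.NavierStokesRegularity.NavierStokesRegularity.Theorems

end
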